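import Mathlib.RingTheory.MvPolynomial.Symmetric.NewtonIdentities
import Mathlib.Algebra.BigOperators.Fin
import Mathlib.Data.Fintype.BigOperators
import Literature.Computability.AlgebraicComplexity.SetMultilinear
import HarnessLib

/-!
# Set-multilinear parts of a product gate via Newton's identities

(N. Limaye, S. Srinivasan, S. Tavenas, *Superpolynomial lower bounds against low-depth algebraic
circuits*, J. ACM 72 (2025), Art. 26 = FOCS 2021, §3 (Prop. 9, Lemmas 11–12) and §7
(Lemmas 19–20).)

LST homogenise a product gate `T = ∏_j (c_j + y_{1,j} + ⋯ + y_{d,j})` of large fan-in by the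
(weighted) Newton identities (Lemma 20: the degree-`d` part of `T` is a `ΣΠΣΠ` formula of size
`s · 2^{O(√d)}` in the homogeneous components of the factors) and then set-multilinearise
(Lemma 12). This file proves the *semantic* content of these two lemmas in the form consumed by
the rank argument, directly for the set-multilinear projections `smlProj` of
`SetMultilinear.lean` and for an arbitrary *list* `L` of factors (repetitions = multiplicities are
allowed; they only enter as scalars of the power sums):

* `smlProj blk S L.prod` lies in the `K`-span of the explicit finite family `newtonGen blk L S` of
  *structured products* (`smlProj_list_prod_mem_span_newtonGen`): each generator is a product,
  over a labelled partition of `S`, of projections `smlProj U u` of the constant-free factors `u`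
  of `L` and of projections `smlProj U (newtonPow L i)` of the *power sums*
  `newtonPow L i = ∑_l y_l ^ i` of the normalised constant-full factors `y_l = c_l⁻¹ u_l - 1`;
  the family has at most `(#S + 1) ^ (4 #S + 1)` members when at most `#S` factors are
  constant-free (`card_newtonIdx_le`), and `smlProj blk S L.prod = 0` otherwise
  (`smlProj_list_prod_eq_zero_of_card_lt_zeroOps`);
* each power-sum projection `smlProj U (newtonPow L i)` lies in the span of the products
  `∏_{q < i} smlProj (blockPart U b q) u` over the constant-full factors `u` of `L` and the
  labelled partitions `b` of `U` into `i` parts (`smlProj_newtonPow_mem_span`).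

The algebra behind it: `∏_l (1 + y_l) = ∑_j e_j(y)` and, in characteristic `0`, Newton's
identities (Mathlib's `MvPolynomial.mul_esymm_eq_sum`) give
`e_j ∈ span_K {p_{λ_1} ⋯ p_{λ_ℓ} : λ ⊢ j}` with the power sums `p_i` (`esymm_mem_span_psumProd`,
generators indexed with harmless repetitions by `ℓ ≤ m` and `λ : Fin ℓ → {0, …, m}`); products of
more than `#S` constant-free factors have no set-multilinear part over `S`
(`SetMultilinear.lean`), which truncates everything at `j ≤ #S` — the rôle played by
"homogeneous components of degree `≤ d`" in LST.

Nothing here is specific to circuits; `K` is a field of characteristic `0`.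

## References

* N. Limaye, S. Srinivasan, S. Tavenas, J. ACM 72 (2025), Art. 26, Lemma 12 (p. 26:11),
  Lemma 19 and Lemma 20 (pp. 26:15–26:20), eq. (3)–(4).
-/

noncomputable section

open MvPolynomial Finsupp

namespace Literature.Computability.AlgebraicComplexity

universe u v w

/-! ### Newton's identities: elementary symmetric polynomials in the span of power-sum products -/

section Newton

variable (K : Type u) [Field K] (n m : ℕ)

/-- Index of a *power-sum product* with at most `m` factors of degrees at most `m`: a number of
parts `ℓ ≤ m` and part sizes `κ q ≤ m` (an integer partition, up to order and padding; repetitions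
and junk entries are harmless for span statements). [folklore] -/
abbrev PsumIdx (m : ℕ) : Type := Σ ℓ : Fin (m + 1), (Fin ℓ → Fin (m + 1))

/-- The power-sum product `p_κ = ∏_q p_{κ q}` in `n` variables (LST 2025, §7, the monomials
`(WPow^1)^{γ_1} ⋯ (WPow^d)^{γ_d}` of the determinant expansion, p. 26:19).
[cite: LimayeSrinivasanTavenas2025, Lemma 20] -/
def psumProd (κ : PsumIdx m) : MvPolynomial (Fin n) K :=
  ∏ q : Fin κ.1, psum (Fin n) K (κ.2 q)

/-- The number of power-sum product indices is at most `(m + 1) ^ (m + 1)`. [folklore] -/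
theorem card_psumIdx_le : Fintype.card (PsumIdx m) ≤ (m + 1) ^ (m + 1) := by
  classical
  rw [Fintype.card_sigma]
  calc ∑ ℓ : Fin (m + 1), Fintype.card (Fin ℓ → Fin (m + 1))
      ≤ ∑ _ℓ : Fin (m + 1), (m + 1) ^ m := Finset.sum_le_sum fun ℓ _ => by
        rw [Fintype.card_fun, Fintype.card_fin, Fintype.card_fin]
        exact Nat.pow_le_pow_right (Nat.succ_pos m) (Nat.lt_succ_iff.1 ℓ.2)
    _ = (m + 1) ^ (m + 1) := by
        rw [Finset.sum_const, Finset.card_univ, Fintype.card_fin, smul_eq_mul, pow_succ']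

variable [CharZero K]

/-- **Newton's identities, span form**: over a field of characteristic `0`, the elementary
symmetric polynomial `e_k`, `k ≤ m`, lies in the `K`-span of the power-sum products
`p_{κ_1} ⋯ p_{κ_ℓ}` with `ℓ ≤ k` (by induction on `k` from Mathlib's
`MvPolynomial.mul_esymm_eq_sum`, `k e_k = ∑_{i=1}^{k} (-1)^{i-1} e_{k-i} p_i`, dividing by `k`);
this is the expansion `WESym^d = ∑_γ κ_γ (WPow^1)^{γ_1} ⋯ (WPow^d)^{γ_d}` of LST 2025, §7
(p. 26:19) in its unweighted form. [cite: LimayeSrinivasanTavenas2025, Lemma 20] -/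
theorem esymm_mem_span_psumProd_of_le {k : ℕ} (hk : k ≤ m) :
    esymm (Fin n) K k ∈ Submodule.span K
      {x | ∃ κ : PsumIdx m, (κ.1 : ℕ) ≤ k ∧ psumProd K n m κ = x} := by
  induction k using Nat.strong_induction_on with
  | _ k ih =>
    rcases Nat.eq_zero_or_pos k with rfl | hpos
    · rw [esymm_zero]
      refine Submodule.subset_span ⟨⟨⟨0, Nat.succ_pos m⟩, fun q => q.elim0⟩, le_rfl, ?_⟩
      simp [psumProd]
    have hk0 : (k : K) ≠ 0 := Nat.cast_ne_zero.mpr hpos.ne'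
    have key := MvPolynomial.mul_esymm_eq_sum (Fin n) K k
    have hCk : esymm (Fin n) K k =
        (k : K)⁻¹ • ((k : MvPolynomial (Fin n) K) * esymm (Fin n) K k) := by
      rw [smul_eq_C_mul, ← mul_assoc,
        show (k : MvPolynomial (Fin n) K) = C (k : K) from (map_natCast C k).symm,
        ← map_mul, inv_mul_cancel₀ hk0, C_1, one_mul]
    have hneg : ∀ i : ℕ, ((-1 : MvPolynomial (Fin n) K) ^ i) = C ((-1 : K) ^ i) := fun i => by
      rw [map_pow, map_neg, C_1]
    rw [hCk, key, hneg, C_mul']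
    refine Submodule.smul_mem _ _ (Submodule.smul_mem _ _ (Submodule.sum_mem _ fun a ha => ?_))
    rw [Finset.mem_filter, Finset.mem_antidiagonal] at ha
    obtain ⟨hab, halt⟩ := ha
    have hsummand : (-1 : MvPolynomial (Fin n) K) ^ a.1 * esymm (Fin n) K a.1 * psum (Fin n) K a.2 =
        ((-1 : K) ^ a.1) • (psum (Fin n) K a.2 * esymm (Fin n) K a.1) := by
      rw [hneg, mul_assoc, C_mul', mul_comm (esymm (Fin n) K a.1) (psum (Fin n) K a.2)]
    rw [hsummand]
    refine Submodule.smul_mem _ _ ?_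
    -- `psum a.2 * esymm a.1`, with `esymm a.1` in the span of the products with `≤ a.1` parts
    have hmem := ih a.1 halt (by omega)
    have himg : psum (Fin n) K a.2 * esymm (Fin n) K a.1 ∈
        Submodule.span K (LinearMap.mulLeft K (psum (Fin n) K a.2) ''
          {x | ∃ κ : PsumIdx m, (κ.1 : ℕ) ≤ a.1 ∧ psumProd K n m κ = x}) := by
      rw [← Submodule.map_span]
      exact Submodule.mem_map_of_mem hmem
    refine Submodule.span_mono ?_ himg
    rintro _ ⟨_, ⟨κ, hκ, rfl⟩, rfl⟩
    obtain ⟨⟨ℓ, hℓ⟩, κ⟩ := κ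
    simp only at hκ
    -- append the part `a.2`
    refine ⟨⟨⟨ℓ + 1, by omega⟩, Fin.snoc κ ⟨a.2, by omega⟩⟩, by simp only; omega, ?_⟩
    rw [LinearMap.mulLeft_apply, psumProd, psumProd, Fin.prod_univ_castSucc]
    simp only [Fin.snoc_castSucc, Fin.snoc_last]
    ring

/-- Newton's identities, span form over the full index family `PsumIdx m`: for `k ≤ m`,
`e_k ∈ span_K (range psumProd)`. [cite: LimayeSrinivasanTavenas2025, Lemma 20] -/
theorem esymm_mem_span_psumProd {k : ℕ} (hk : k ≤ m) :
    esymm (Fin n) K k ∈ Submodule.span K (Set.range (psumProd K n m)) := by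
  refine Submodule.span_mono ?_ (esymm_mem_span_psumProd_of_le K n m hk)
  rintro _ ⟨κ, -, rfl⟩
  exact ⟨κ, rfl⟩

end Newton

/-! ### A product gate: constant-free factors, normalised factors, power sums -/

section ProductGate

variable {K : Type u} [Field K] {σ : Type v} {ι : Type w}

/-- The *constant-free* factors of a list of factors (those with zero constant term), with their
multiplicities (LST 2025, proof of Lemma 20, p. 26:19: "the case `c_j = 0`").
[cite: LimayeSrinivasanTavenas2025, Lemma 20] -/
def zeroOps (L : List (MvPolynomial σ K)) : List (MvPolynomial σ K) :=
  letI := Classical.decEq K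
  L.filter fun u => decide (coeff 0 u = 0)

/-- The *constant-full* factors of a list of factors (those with nonzero constant term `c_j`),
with their multiplicities (LST 2025, proof of Lemma 20, "if `c_j ≠ 0`, then by dividing by `c_j`
we come back to the case `c_j = 1`"). [cite: LimayeSrinivasanTavenas2025, Lemma 20] -/
def unitOps (L : List (MvPolynomial σ K)) : List (MvPolynomial σ K) :=
  letI := Classical.decEq K
  L.filter fun u => !decide (coeff 0 u = 0)

/-- Members of `zeroOps` have zero constant term. [cite: LimayeSrinivasanTavenas2025, Lemma 20] -/
theorem coeff_zero_of_mem_zeroOps {L : List (MvPolynomial σ K)} {u : MvPolynomial σ K}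
    (hu : u ∈ zeroOps L) : coeff 0 u = 0 := by
  unfold zeroOps at hu
  rw [List.mem_filter] at hu
  simpa using hu.2

/-- Members of `unitOps` have nonzero constant term.
[cite: LimayeSrinivasanTavenas2025, Lemma 20] -/
theorem coeff_zero_ne_of_mem_unitOps {L : List (MvPolynomial σ K)} {u : MvPolynomial σ K}
    (hu : u ∈ unitOps L) : coeff 0 u ≠ 0 := by
  unfold unitOps at hu
  rw [List.mem_filter] at hu
  simpa using hu.2

/-- A list product splits into the product over a `Bool`-filter and its complement. [folklore] -/
theorem list_prod_filter_mul_prod_filter_not {M : Type*} [CommMonoid M] (L : List M)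
    (p : M → Bool) : (L.filter p).prod * (L.filter fun a => !p a).prod = L.prod := by
  induction L with
  | nil => simp
  | cons a L ih =>
    cases h : p a
    · rw [List.filter_cons_of_neg (by simp [h]), List.filter_cons_of_pos (by simp [h]),
        List.prod_cons, List.prod_cons, mul_left_comm, ih]
    · rw [List.filter_cons_of_pos (by simp [h]), List.filter_cons_of_neg (by simp [h]),
        List.prod_cons, List.prod_cons, mul_assoc, ih]

/-- `L.prod = (zeroOps L).prod * (unitOps L).prod`. [cite: LimayeSrinivasanTavenas2025, Lemma 20] -/
theorem prod_eq_zeroOps_prod_mul_unitOps_prod (L : List (MvPolynomial σ K)) :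
    L.prod = (zeroOps L).prod * (unitOps L).prod := by
  unfold zeroOps unitOps
  exact (list_prod_filter_mul_prod_filter_not L _).symm

/-- `zeroOps L` is no longer than `L`. [folklore] -/
theorem length_zeroOps_le (L : List (MvPolynomial σ K)) : (zeroOps L).length ≤ L.length :=
  List.length_filter_le _ _

/-- `unitOps L` is no longer than `L`. [folklore] -/
theorem length_unitOps_le (L : List (MvPolynomial σ K)) : (unitOps L).length ≤ L.length :=
  List.length_filter_le _ _

/-- Every member of `unitOps L` is a member of `L`. [folklore] -/
theorem mem_of_mem_unitOps {L : List (MvPolynomial σ K)} {u : MvPolynomial σ K}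
    (hu : u ∈ unitOps L) : u ∈ L :=
  List.mem_of_mem_filter hu

/-- Every member of `zeroOps L` is a member of `L`. [folklore] -/
theorem mem_of_mem_zeroOps {L : List (MvPolynomial σ K)} {u : MvPolynomial σ K}
    (hu : u ∈ zeroOps L) : u ∈ L :=
  List.mem_of_mem_filter hu

/-- The constant term `c_l ≠ 0` of the `l`-th constant-full factor.
[cite: LimayeSrinivasanTavenas2025, Lemma 20] -/
def unitConst (L : List (MvPolynomial σ K)) (l : Fin (unitOps L).length) : K :=
  coeff 0 (unitOps L)[(l : ℕ)]

/-- `c_l ≠ 0`. [cite: LimayeSrinivasanTavenas2025, Lemma 20] -/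
theorem unitConst_ne_zero (L : List (MvPolynomial σ K)) (l : Fin (unitOps L).length) :
    unitConst L l ≠ 0 :=
  coeff_zero_ne_of_mem_unitOps (List.getElem_mem _)

/-- The *normalised* constant-full factor `y_l = c_l⁻¹ u_l - 1` (zero constant term), so that
`u_l = c_l (1 + y_l)` (LST 2025, proof of Lemma 20, `(c_j + ∑ y_{i,j}) = c_j (1 + ∑ y_{i,j}/c_j)`).
[cite: LimayeSrinivasanTavenas2025, Lemma 20] -/
def newtonY (L : List (MvPolynomial σ K)) (l : Fin (unitOps L).length) : MvPolynomial σ K :=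
  C (unitConst L l)⁻¹ * ((unitOps L)[(l : ℕ)] - C (unitConst L l))

/-- `y_l` has zero constant term. [cite: LimayeSrinivasanTavenas2025, Lemma 20] -/
theorem coeff_zero_newtonY (L : List (MvPolynomial σ K)) (l : Fin (unitOps L).length) :
    coeff 0 (newtonY L l) = 0 := by
  simp [newtonY, unitConst]

/-- `u_l = c_l · (1 + y_l)`. [cite: LimayeSrinivasanTavenas2025, Lemma 20] -/
theorem unitOps_getElem_eq (L : List (MvPolynomial σ K)) (l : Fin (unitOps L).length) :
    (unitOps L)[(l : ℕ)] = C (unitConst L l) * (1 + newtonY L l) := by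
  rw [newtonY, mul_add, mul_one, ← mul_assoc, ← map_mul,
    mul_inv_cancel₀ (unitConst_ne_zero L l), C_1, one_mul, add_sub_cancel]

/-- The *power sums* `p_i(y) = ∑_l y_l ^ i` of the normalised factors (LST 2025, §7, the
unweighted specialisation of `WPow^i`). [cite: LimayeSrinivasanTavenas2025, Lemma 20] -/
def newtonPow (L : List (MvPolynomial σ K)) (i : ℕ) : MvPolynomial σ K :=
  ∑ l : Fin (unitOps L).length, newtonY L l ^ i

/-- The *elementary symmetric polynomials* `e_j(y)` of the normalised factors (LST 2025, §7, the
unweighted specialisation of `WESym^j`). [cite: LimayeSrinivasanTavenas2025, Lemma 20] -/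
def newtonE (L : List (MvPolynomial σ K)) (j : ℕ) : MvPolynomial σ K :=
  aeval (newtonY L) (esymm (Fin (unitOps L).length) K j)

/-- `e_j(y) = ∑_{|t| = j} ∏_{l ∈ t} y_l`. [cite: LimayeSrinivasanTavenas2025, Lemma 20] -/
theorem newtonE_eq_sum (L : List (MvPolynomial σ K)) (j : ℕ) :
    newtonE L j = ∑ t ∈ Finset.powersetCard j Finset.univ, ∏ l ∈ t, newtonY L l := by
  simp [newtonE, esymm, map_sum, map_prod]

/-- Power sums are the images of Mathlib's `psum` under `y`.
[cite: LimayeSrinivasanTavenas2025, Lemma 20] -/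
theorem aeval_newtonY_psum (L : List (MvPolynomial σ K)) (i : ℕ) :
    aeval (newtonY L) (psum (Fin (unitOps L).length) K i) = newtonPow L i := by
  simp [psum, newtonPow, map_sum, map_pow]

/-- **`∏_l (1 + y_l) = ∑_{j ≤ n} e_j(y)`** (LST 2025, eq. (3), `T^{(d)} = WESym^d` summed over
`d`; here: the product of the normalised factors is the sum of all their elementary symmetric
polynomials). [cite: LimayeSrinivasanTavenas2025, Lemma 20] -/
theorem prod_one_add_newtonY (L : List (MvPolynomial σ K)) :
    ∏ l : Fin (unitOps L).length, (1 + newtonY L l) =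
      ∑ j ∈ Finset.range ((unitOps L).length + 1), newtonE L j := by
  rw [Finset.prod_one_add, Finset.powerset_card_disjiUnion, Finset.sum_disjiUnion,
    Finset.card_univ, Fintype.card_fin]
  refine Finset.sum_congr rfl fun j _ => ?_
  rw [newtonE_eq_sum]

/-- **`(unitOps L).prod = C (∏ c_l) · ∏_l (1 + y_l)`**.
[cite: LimayeSrinivasanTavenas2025, Lemma 20] -/
theorem unitOps_prod_eq (L : List (MvPolynomial σ K)) :
    (unitOps L).prod = C (∏ l : Fin (unitOps L).length, unitConst L l) *
      ∏ l : Fin (unitOps L).length, (1 + newtonY L l) := by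
  rw [← Fin.prod_univ_getElem (unitOps L), map_prod, ← Finset.prod_mul_distrib]
  exact Finset.prod_congr rfl fun l _ => unitOps_getElem_eq L l

/-- `e_j(y)` has no set-multilinear part over fewer than `j` blocks (each summand is a product of
`j` constant-free factors; LST 2025, §7: components of weighted degree `> d` are discarded).
[cite: LimayeSrinivasanTavenas2025, Lemma 20] -/
theorem smlProj_newtonE_eq_zero (blk : σ → ι) (L : List (MvPolynomial σ K)) {S : Finset ι} {j : ℕ}
    (h : S.card < j) : smlProj blk S (newtonE L j) = 0 := by
  rw [newtonE_eq_sum, map_sum]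
  refine Finset.sum_eq_zero fun t ht => ?_
  rw [Finset.mem_powersetCard] at ht
  rw [← Finset.prod_map_toList t (newtonY L)]
  refine smlProj_list_prod_eq_zero_of_card_lt blk S _ (fun f hf => ?_) ?_
  · obtain ⟨l, -, rfl⟩ := List.mem_map.1 hf
    exact coeff_zero_newtonY L l
  · rw [List.length_map, Finset.length_toList, ht.2]
    exact h

variable [DecidableEq ι] (blk : σ → ι)

/-- The zero-constant part: if more than `#S` factors of `L` are constant-free then the product
has no set-multilinear part over `S` (LST 2025, proof of Lemma 20: "if there are more than `d`
many `j` such that `c_j = 0`, then `T^{(d)}` is the zero polynomial").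
[cite: LimayeSrinivasanTavenas2025, Lemma 20] -/
theorem smlProj_list_prod_eq_zero_of_card_lt_zeroOps (L : List (MvPolynomial σ K))
    {S : Finset ι} (h : S.card < (zeroOps L).length) : smlProj blk S L.prod = 0 := by
  rw [prod_eq_zeroOps_prod_mul_unitOps_prod, smlProj_mul]
  refine Finset.sum_eq_zero fun S₀ hS₀ => ?_
  rw [smlProj_list_prod_eq_zero_of_card_lt blk S₀ _ (fun u hu => coeff_zero_of_mem_zeroOps hu)
    ((Finset.card_le_card (Finset.mem_powerset.1 hS₀)).trans_lt h), zero_mul]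

/-! #### Power sums: projections in the span of structured products of the factors -/

omit [DecidableEq ι] in
/-- `smlProj` commutes with multiplication by constants. [folklore] -/
theorem smlProj_C_mul (S : Finset ι) (a : K) (f : MvPolynomial σ K) :
    smlProj blk S (C a * f) = C a * smlProj blk S f := by
  unfold smlProj
  rw [weightedHomogeneousComponent_C_mul]

/-- The projections of a normalised factor are scalar multiples of those of the factor itself:
`smlProj U y_l = c_l⁻¹ • smlProj U u_l` for `U ≠ ∅`, and `0` for `U = ∅`.
[cite: LimayeSrinivasanTavenas2025, Lemma 20] -/
theorem smlProj_newtonY (L : List (MvPolynomial σ K)) (l : Fin (unitOps L).length)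
    (U : Finset ι) :
    smlProj blk U (newtonY L l) =
      if U = ∅ then 0 else C (unitConst L l)⁻¹ * smlProj blk U (unitOps L)[(l : ℕ)] := by
  split_ifs with hU
  · rw [hU, smlProj_empty_eq_zero blk (coeff_zero_newtonY L l)]
  · rw [newtonY, smlProj_C_mul, map_sub, smlProj_C, if_neg hU, sub_zero]

/-- **Projections of the power sums** (LST 2025, Lemma 12 applied to the `ΣΠ` formula `WPow^i`):
`smlProj U (p_i(y))` lies in the `K`-span of the products `∏_{q < i} smlProj (blockPart U b q) u`
over the constant-full factors `u` of `L` and the labelled partitions `b : ↥U → Fin i`.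
[cite: LimayeSrinivasanTavenas2025, Lemma 12] -/
theorem smlProj_newtonPow_mem_span (L : List (MvPolynomial σ K)) (U : Finset ι) (i : ℕ) :
    smlProj blk U (newtonPow L i) ∈ Submodule.span K
      (Set.range fun p : Fin (unitOps L).length × (U → Fin i) =>
        ∏ q : Fin i, smlProj blk (blockPart U p.2 q) (unitOps L)[(p.1 : ℕ)]) := by
  unfold newtonPow
  rw [map_sum]
  refine Submodule.sum_mem _ fun l _ => ?_
  refine (Submodule.span_le.2 ?_) (smlProj_pow_mem_span blk U (newtonY L l) i)
  rintro _ ⟨b, rfl⟩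
  simp only [SetLike.mem_coe]
  by_cases hb : ∀ q : Fin i, blockPart U b q ≠ ∅
  · -- all parts nonempty: the term is `c_l^{-i} • ∏_q smlProj (part q) u_l`
    have : (∏ q : Fin i, smlProj blk (blockPart U b q) (newtonY L l)) =
        ((unitConst L l)⁻¹ ^ i) •
          ∏ q : Fin i, smlProj blk (blockPart U b q) (unitOps L)[(l : ℕ)] := by
      rw [← C_mul', map_pow, ← Fin.prod_const i (C (unitConst L l)⁻¹), ← Finset.prod_mul_distrib]
      exact Finset.prod_congr rfl fun q _ => by rw [smlProj_newtonY, if_neg (hb q)]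
    rw [this]
    exact Submodule.smul_mem _ _ (Submodule.subset_span ⟨(l, b), rfl⟩)
  · push Not at hb
    obtain ⟨q, hq⟩ := hb
    have h0 : smlProj blk (blockPart U b q) (newtonY L l) = 0 := by
      rw [smlProj_newtonY, if_pos hq]
    rw [Finset.prod_eq_zero (Finset.mem_univ q) h0]
    exact Submodule.zero_mem _

/-! #### The structured generators for the whole product -/

/-- Index of the power-sum generators on a block set `S'`: a power-sum product index `κ` with at
most `#S'` parts of sizes `≤ #S'`, and a labelled partition `b` of `S'` into `κ.1` parts.
[cite: LimayeSrinivasanTavenas2025, Lemma 20] -/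
abbrev WIdx (S' : Finset ι) : Type w := Σ κ : PsumIdx S'.card, (S' → Fin κ.1)

/-- The power-sum generator `∏_q smlProj (blockPart S' b q) (p_{κ q}(y))` (LST 2025, Lemma 12
applied to the summands of the expansion of `WESym` in power sums).
[cite: LimayeSrinivasanTavenas2025, Lemma 20] -/
def wGen (L : List (MvPolynomial σ K)) (S' : Finset ι) (g : WIdx S') : MvPolynomial σ K :=
  ∏ q : Fin g.1.1, smlProj blk (blockPart S' g.2 q) (newtonPow L (g.1.2 q))

omit [DecidableEq ι] in
/-- **The constant-full part**: `smlProj S' (∏_l (1 + y_l))` lies in the span of the power-sum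
generators `wGen` (expand `∏ (1 + y_l) = ∑_j e_j`, drop `j > #S'`, write `e_j` in power sums by
Newton, project the products part by part). [cite: LimayeSrinivasanTavenas2025, Lemma 20] -/
theorem smlProj_prod_one_add_mem_span_wGen (L : List (MvPolynomial σ K)) [CharZero K]
    (S' : Finset ι) :
    smlProj blk S' (∏ l : Fin (unitOps L).length, (1 + newtonY L l)) ∈
      Submodule.span K (Set.range (wGen blk L S')) := by
  rw [prod_one_add_newtonY, map_sum]
  refine Submodule.sum_mem _ fun j _ => ?_
  by_cases hj : S'.card < j
  · rw [smlProj_newtonE_eq_zero blk L hj]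
    exact Submodule.zero_mem _
  rw [not_lt] at hj
  -- `e_j ∈ span (psumProd)`, pushed along `aeval y` and then along `smlProj S'`
  have h1 : newtonE L j ∈ Submodule.span K
      (Set.range fun κ : PsumIdx S'.card => ∏ q : Fin κ.1, newtonPow L (κ.2 q)) := by
    have h := esymm_mem_span_psumProd K (unitOps L).length S'.card hj
    have h' : aeval (newtonY L) (esymm (Fin (unitOps L).length) K j) ∈
        Submodule.span K ((aeval (newtonY L)).toLinearMap ''
          Set.range (psumProd K (unitOps L).length S'.card)) := by
      rw [← Submodule.map_span]
      exact Submodule.mem_map_of_mem h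
    refine Submodule.span_mono ?_ h'
    rintro _ ⟨_, ⟨κ, rfl⟩, rfl⟩
    refine ⟨κ, ?_⟩
    simp only [AlgHom.toLinearMap_apply, psumProd, map_prod, aeval_newtonY_psum]
  have h2 : smlProj blk S' (newtonE L j) ∈ Submodule.span K ((smlProj blk S') ''
      Set.range fun κ : PsumIdx S'.card => ∏ q : Fin κ.1, newtonPow L (κ.2 q)) := by
    rw [← Submodule.map_span]
    exact Submodule.mem_map_of_mem h1
  refine Submodule.span_le.2 ?_ (Submodule.span_mono (fun x hx => hx) h2)
  rintro _ ⟨_, ⟨κ, rfl⟩, rfl⟩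
  simp only [SetLike.mem_coe]
  -- project the product part by part
  have h3 := smlProj_list_prod_mem_span blk S' (List.ofFn fun q : Fin κ.1 => newtonPow L (κ.2 q))
  rw [List.prod_ofFn] at h3
  refine Submodule.span_mono ?_ h3
  rintro _ ⟨a, rfl⟩
  have hlen : (List.ofFn fun q : Fin κ.1 => newtonPow L (κ.2 q)).length = κ.1 :=
    List.length_ofFn
  refine ⟨⟨κ, fun x => Fin.cast hlen (a x)⟩, ?_⟩
  unfold wGen partProd
  refine (Fintype.prod_equiv (finCongr hlen)
    (fun q => smlProj blk (blockPart S' a q)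
      (List.ofFn fun q : Fin κ.1 => newtonPow L (κ.2 q))[(q : ℕ)])
    (fun q => smlProj blk (blockPart S' (fun x => Fin.cast hlen (a x)) q) (newtonPow L (κ.2 q)))
    fun q => ?_).symm
  have hp : blockPart S' (fun x => Fin.cast hlen (a x)) (finCongr hlen q) = blockPart S' a q := by
    ext i
    simp only [mem_blockPart, finCongr_apply]
    exact ⟨fun ⟨h, h'⟩ => ⟨h, Fin.cast_injective _ h'⟩, fun ⟨h, h'⟩ => ⟨h, by rw [h']⟩⟩
  rw [hp, List.getElem_ofFn]
  rfl

/-- Index of the structured generators of `smlProj S (L.prod)`: the block set `S₀ ⊆ S` taken by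
the constant-free factors, a labelled partition `a` of `S₀` among them, and a power-sum generator
index on `S \ S₀`. [cite: LimayeSrinivasanTavenas2025, Lemma 20] -/
abbrev NewtonIdx (L : List (MvPolynomial σ K)) (S : Finset ι) : Type w :=
  Σ S₀ : S.powerset, ((↥(S₀ : Finset ι) → Fin (zeroOps L).length) × WIdx (S \ ↑S₀))

/-- The structured generator attached to an index: the product, over a labelled partition of `S`,
of the projections of the constant-free factors onto the parts of `S₀` and of the power sums of the
normalised constant-full factors onto the parts of `S \ S₀` (LST 2025, Lemmas 12 and 20 combined).
[cite: LimayeSrinivasanTavenas2025, Lemma 20] -/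
def newtonGen (L : List (MvPolynomial σ K)) (S : Finset ι) (g : NewtonIdx L S) :
    MvPolynomial σ K :=
  partProd blk (g.1 : Finset ι) (zeroOps L) g.2.1 * wGen blk L (S \ g.1) g.2.2

/-- **Set-multilinear parts of a product gate** (semantic form of LST 2025, Lemma 20 followed by
Lemma 12): for any list `L` of factors and any block set `S`, `smlProj S (L.prod)` lies in the
`K`-span of the structured generators `newtonGen blk L S`. Multiplicities of repeated factors only
enter through the scalars of the power sums. [cite: LimayeSrinivasanTavenas2025, Lemma 20] -/
theorem smlProj_list_prod_mem_span_newtonGen [CharZero K] (L : List (MvPolynomial σ K))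
    (S : Finset ι) :
    smlProj blk S L.prod ∈ Submodule.span K (Set.range (newtonGen blk L S)) := by
  rw [prod_eq_zeroOps_prod_mul_unitOps_prod, unitOps_prod_eq, mul_left_comm, smlProj_C_mul,
    C_mul']
  refine Submodule.smul_mem _ _ ?_
  rw [smlProj_mul]
  refine Submodule.sum_mem _ fun S₀ hS₀ => ?_
  -- product of two span members
  have hx := smlProj_list_prod_mem_span blk S₀ (zeroOps L)
  have hy := smlProj_prod_one_add_mem_span_wGen blk L (S \ S₀)
  have hxy := Submodule.mul_mem_mul hx hy
  rw [Submodule.span_mul_span] at hxy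
  refine Submodule.span_mono ?_ hxy
  rintro _ ⟨_, ⟨a, rfl⟩, _, ⟨g, rfl⟩, rfl⟩
  exact ⟨⟨⟨S₀, hS₀⟩, a, g⟩, rfl⟩

/-! #### Counting the generators -/

/-- The number of power-sum generators on `S'` is at most `(#S' + 1) ^ (2 #S' + 1)`. [folklore] -/
theorem card_wIdx_le (S' : Finset ι) :
    Fintype.card (WIdx S') ≤ (S'.card + 1) ^ (2 * S'.card + 1) := by
  classical
  set m := S'.card
  rw [Fintype.card_sigma]
  calc ∑ κ : PsumIdx m, Fintype.card (S' → Fin κ.1)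
      ≤ ∑ _κ : PsumIdx m, (m + 1) ^ m := Finset.sum_le_sum fun κ _ => by
        rw [Fintype.card_fun, Fintype.card_fin, Fintype.card_coe]
        exact Nat.pow_le_pow_left (by have := κ.1.2; omega) m
    _ = Fintype.card (PsumIdx m) * (m + 1) ^ m := by
        rw [Finset.sum_const, Finset.card_univ, smul_eq_mul]
    _ ≤ (m + 1) ^ (m + 1) * (m + 1) ^ m :=
        Nat.mul_le_mul_right _ (card_psumIdx_le m)
    _ = (m + 1) ^ (2 * m + 1) := by rw [← pow_add]; ring_nf

/-- **The number of structured generators is at most `(#S + 1) ^ (4 #S + 1)`** when at most `#S`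
factors are constant-free (otherwise the projection vanishes,
`smlProj_list_prod_eq_zero_of_card_lt_zeroOps`): the `d^{O(d)}` of LST 2025, Prop. 9.
[cite: LimayeSrinivasanTavenas2025, Prop. 9] -/
theorem card_newtonIdx_le (L : List (MvPolynomial σ K)) (S : Finset ι)
    (hz : (zeroOps L).length ≤ S.card) :
    Fintype.card (NewtonIdx L S) ≤ (S.card + 1) ^ (4 * S.card + 1) := by
  classical
  set m := S.card with hm
  rw [Fintype.card_sigma]
  have hS₀ : ∀ S₀ : S.powerset,
      Fintype.card ((↥(S₀ : Finset ι) → Fin (zeroOps L).length) × WIdx (S \ ↑S₀)) ≤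
        (m + 1) ^ m * (m + 1) ^ (2 * m + 1) := by
    rintro ⟨S₀, hS₀⟩
    rw [Finset.mem_powerset] at hS₀
    rw [Fintype.card_prod, Fintype.card_fun, Fintype.card_fin, Fintype.card_coe]
    refine Nat.mul_le_mul ?_ ?_
    · calc (zeroOps L).length ^ S₀.card ≤ (m + 1) ^ S₀.card :=
            Nat.pow_le_pow_left (by omega) _
        _ ≤ (m + 1) ^ m := Nat.pow_le_pow_right (Nat.succ_pos m) (Finset.card_le_card hS₀)
    · refine (card_wIdx_le (S \ S₀)).trans ?_
      have hc : (S \ S₀).card ≤ m := Finset.card_le_card Finset.sdiff_subset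
      calc ((S \ S₀).card + 1) ^ (2 * (S \ S₀).card + 1)
          ≤ (m + 1) ^ (2 * (S \ S₀).card + 1) := Nat.pow_le_pow_left (by omega) _
        _ ≤ (m + 1) ^ (2 * m + 1) := Nat.pow_le_pow_right (Nat.succ_pos m) (by omega)
  calc ∑ S₀ : S.powerset,
        Fintype.card ((↥(S₀ : Finset ι) → Fin (zeroOps L).length) × WIdx (S \ ↑S₀))
      ≤ ∑ _S₀ : S.powerset, (m + 1) ^ m * (m + 1) ^ (2 * m + 1) :=
        Finset.sum_le_sum fun S₀ _ => hS₀ S₀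
    _ = 2 ^ m * ((m + 1) ^ m * (m + 1) ^ (2 * m + 1)) := by
        rw [Finset.sum_const, Finset.card_univ, Fintype.card_coe, Finset.card_powerset,
          smul_eq_mul]
    _ ≤ (m + 1) ^ m * ((m + 1) ^ m * (m + 1) ^ (2 * m + 1)) := by
        refine Nat.mul_le_mul_right _ ?_
        rcases Nat.eq_zero_or_pos m with h0 | hpos
        · simp [h0]
        · exact Nat.pow_le_pow_left (by omega) _
    _ = (m + 1) ^ (4 * m + 1) := by rw [← pow_add, ← pow_add]; ring_nf

/-! #### What the generators look like (for the rank analysis) -/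

/-- Unfolding a structured generator: a product over the labelled partition
`(blockPart S₀ a ·) ⊔ (blockPart (S \ S₀) b ·)` of `S` of projections of constant-free factors of
`L` and of power sums. [cite: LimayeSrinivasanTavenas2025, Lemma 20] -/
theorem newtonGen_eq (L : List (MvPolynomial σ K)) (S : Finset ι) (g : NewtonIdx L S) :
    newtonGen blk L S g =
      (∏ q : Fin (zeroOps L).length, smlProj blk (blockPart (g.1 : Finset ι) g.2.1 q)
          (zeroOps L)[(q : ℕ)]) *
        ∏ q : Fin g.2.2.1.1, smlProj blk (blockPart (S \ g.1) g.2.2.2 q)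
          (newtonPow L (g.2.2.1.2 q)) :=
  rfl

/-- Each structured generator is set-multilinear over `S`.
[cite: LimayeSrinivasanTavenas2025, Lemma 12] -/
theorem isSetMultilinear_newtonGen (L : List (MvPolynomial σ K)) (S : Finset ι)
    (g : NewtonIdx L S) : IsSetMultilinear blk S (newtonGen blk L S g) := by
  obtain ⟨⟨S₀, hS₀⟩, a, κ, b⟩ := g
  rw [Finset.mem_powerset] at hS₀
  have h1 := isSetMultilinear_partProd blk S₀ (zeroOps L) a
  have h2 : IsSetMultilinear blk (S \ S₀) (wGen blk L (S \ S₀) ⟨κ, b⟩) := by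
    unfold wGen IsSetMultilinear
    have h := IsWeightedHomogeneous.prod (w := blockWeight blk) Finset.univ
      (fun q : Fin κ.1 => smlProj blk (blockPart (S \ S₀) b q) (newtonPow L (κ.2 q)))
      (fun q => blockProfile (blockPart (S \ S₀) b q))
      (fun q _ => isSetMultilinear_smlProj blk _ _)
    convert h using 1
    unfold blockProfile
    rw [← Finset.sum_biUnion fun q _ q' _ h => disjoint_blockPart b h, biUnion_blockPart]
  have := h1.mul blk h2 Finset.disjoint_sdiff
  rwa [Finset.union_sdiff_of_subset hS₀] at this

end ProductGate

end Literature.Computability.AlgebraicComplexity
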